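import Literature.Topology.FourManifolds.KhInsertChord
import Literature.Topology.FourManifolds.KhFlipReach
import Literature.Topology.FourManifolds.KhResolutionsProofs
import Literature.Topology.FourManifolds.KhResolutionsParityProofs
import HarnessLib

/-!
# The curl of the first Reidemeister move on a Gauss diagram: arcs and state circles

Sibling file of `KhResolutions.lean` / `KhComplex.lean`, a brick of the invariance programme for
`Literature.Topology.FourManifolds.GaussDiagram.nonempty_iso_khovanovHomology_of_equiv`
(Khovanov (2000), Thm. 1), treating the **first Reidemeister move** (Khovanov (2000), §5.1–5.2;
Bar-Natan (2002), §4; on Gauss diagrams: Polyak (2010), §2, `Ω1`; `PolyakMove.omega1a/b`).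

`G.curl tf ε` is `G` with an isolated chord of sign `ε` inserted at the two *last* positions
`2n, 2n + 1` (`tf = true`: tail `2n`, head `2n + 1`, the move `omega1a` at `p = Fin.last (2n)`;
`tf = false`: head first, `omega1b`); a general `Ω1` is a rotation of this one. Old marked points
keep their numbers (`overPos_curl_castSucc`), so the arcs of the new diagram are: the old arcs
`arcOut q` for `q < 2n - 1` verbatim, the **loop** `curlLoop` (the arc from `2n` to `2n + 1`), and
the two halves `arcIn 2n` (number `2n - 1`) and `curlOut` (number `2n + 1`) of the old arc number
`2n - 1` (`baseArc`), which the two new points subdivide. The projection `curlProj` sends every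
new arc to the old arc containing it (the loop going to `baseArc`). States of the new diagram
are written `curlState σ b` (old smoothings `σ`, smoothing `b` of the curl), and `curlSeif b ε`
records whether `b` is Seifert's smoothing of the curl.

Main results:

* `reachable_curlProj` — reachability in the new state graph projects to reachability in the
  old one; `reachable_curl_of_reachable` — conversely old reachability lifts to the new arcs off
  the loop (and to the loop as well outside Seifert's smoothing of the curl,
  `reachable_curlLoop_curlOut`);
* `eq_curlLoop_of_reachable` — in Seifert's smoothing of the curl the loop is a state circle by
  itself: **resolving the curl à la Seifert splits off one small circle, the other resolution
  changes nothing** (Khovanov (2000), §5.1: `D'` resolves to `D ⊔ ○` and to `D`; Bar-Natan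
  (2002), §4);
* `circleOf_curl_eq_iff_of_not_seif`, `circleOf_curl_eq_iff_of_seif` — the resulting description
  of the state circles of the new diagram; `isMergeAt_curl_castSucc_iff` /
  `isSplitAt_curl_castSucc_iff` (old chords merge/split exactly as before) and
  `isMergeAt_curl_last_iff` / `isSplitAt_curl_last_iff` (the curl is a merge for `ε = 1` and a
  split for `ε = -1`, never a one-to-one bifurcation — for *every* Gauss diagram, no planarity).

Everything is proved; no named fact is introduced.

## References

* M. Khovanov, *A categorification of the Jones polynomial*, Duke Math. J. 101 (2000) 359–426,
  §5.1 (left-twisted curl), §5.2 (right-twisted curl). [cite: Khovanov2000, §5.1]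
* D. Bar-Natan, *On Khovanov's categorification of the Jones polynomial*, Algebr. Geom. Topol. 2
  (2002) 337–370, §4 (invariance under `R1`). [cite: BarNatan2002, §4]
* M. Polyak, *Minimal generating sets of Reidemeister moves*, Quantum Topol. 1 (2010), §2,
  Fig. 2 (`Ω1a–d` on Gauss diagrams). [cite: Polyak2010, §2]
* O. Viro, *Khovanov homology, its definitions and ramifications*, Fund. Math. 184 (2004), §5
  (resolutions of Gauss diagrams). [cite: Viro2004, §5]
-/

open Function Set

noncomputable section

namespace Literature.Topology.FourManifolds

namespace GaussDiagram

variable (G : GaussDiagram) (tf : Bool) (ε : ℤˣ)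

/-! ## The curl at the last two positions -/

/-- The new marked point number `2n` (the first of the two points of the curl). [folklore] -/
def curlFst : Fin (2 * G.n + 2) := ⟨2 * G.n, by omega⟩

/-- The new marked point number `2n + 1` (the second of the two points of the curl). [folklore] -/
def curlSnd : Fin (2 * G.n + 2) := ⟨2 * G.n + 1, by omega⟩

/-- The value of `curlFst`. [folklore] -/
@[simp] theorem val_curlFst : (G.curlFst : ℕ) = 2 * G.n := rfl

/-- The value of `curlSnd`. [folklore] -/
@[simp] theorem val_curlSnd : (G.curlSnd : ℕ) = 2 * G.n + 1 := rfl

/-- The two new points are distinct. [folklore] -/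
theorem curlFst_ne_curlSnd : G.curlFst ≠ G.curlSnd := fun h ↦ by
  have := congrArg Fin.val h; simp at this

/-- The over-passage of the curl: position `2n` for `tf = true` (tail first, `Ω1` entered along
the over-strand, `PolyakMove.omega1a`), position `2n + 1` for `tf = false` (head first,
`PolyakMove.omega1b`). Polyak (2010), Fig. 2. [cite: Polyak2010, §2] -/
def curlPos : Fin (2 * G.n + 2) :=
  if tf then (Fin.last (2 * G.n)).castSucc else (Fin.last (2 * G.n)).succ

/-- **The curl** (first Reidemeister move) with the new chord, of sign `ε`, at the two last
positions `2n, 2n + 1` of the Gauss diagram: `G.insertChord p.castSucc p ε` (`tf = true`) or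
`G.insertChord p.succ p ε` (`tf = false`) at `p = Fin.last (2n)`, i.e. the targets of
`PolyakMove.omega1a G p ε` / `PolyakMove.omega1b G p ε` there. Polyak (2010), §2, Fig. 2;
Khovanov (2000), §5.1–5.2. [cite: Polyak2010, §2] -/
def curl : GaussDiagram :=
  G.insertChord (G.curlPos tf) (Fin.last (2 * G.n)) ε

/-- The curl entered along the over-strand is the target of `PolyakMove.omega1a` at the last
position. [folklore] -/
theorem curl_true :
    G.curl true ε = G.insertChord (Fin.last (2 * G.n)).castSucc (Fin.last (2 * G.n)) ε := rfl

/-- The curl entered along the under-strand is the target of `PolyakMove.omega1b` at the last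
position. [folklore] -/
theorem curl_false :
    G.curl false ε = G.insertChord (Fin.last (2 * G.n)).succ (Fin.last (2 * G.n)) ε := rfl

/-- The curled diagram is a Polyak move away from `G`. Polyak (2010), Thm. 1.1. [cite: Polyak2010, Thm 1.1] -/
theorem polyakMove_curl : PolyakMove G (G.curl tf ε) := by
  cases tf
  · exact PolyakMove.omega1b G _ ε
  · exact PolyakMove.omega1a G _ ε

/-- The curled diagram has one more chord. [folklore] -/
@[simp] theorem curl_n : (G.curl tf ε).n = G.n + 1 := rfl

/-- The over-passage of the curl is `2n` or `2n + 1`. [folklore] -/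
theorem curlPos_eq : G.curlPos tf = if tf then G.curlFst else G.curlSnd := by
  unfold curlPos
  split_ifs <;> exact Fin.ext (by simp [curlFst, curlSnd])

/-- The under-passage of the curl is the other one of `2n`, `2n + 1`. [folklore] -/
theorem succAbove_curlPos :
    (G.curlPos tf).succAbove (Fin.last (2 * G.n)) = if tf then G.curlSnd else G.curlFst := by
  unfold curlPos
  split_ifs
  · rw [Fin.succAbove_castSucc_self]; exact Fin.ext (by simp [curlSnd])
  · rw [Fin.succAbove_succ_self]; exact Fin.ext (by simp [curlFst])

/-- Inserting the curl at the end does not renumber the old marked points. [folklore] -/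
theorem insEmb_curlPos (q : Fin (2 * G.n)) :
    G.insEmb (G.curlPos tf) (Fin.last (2 * G.n)) q = q.castSucc.castSucc := by
  unfold insEmb
  rw [Fin.succAbove_last]
  refine Fin.succAbove_of_castSucc_lt _ _ ?_
  rw [curlPos_eq, Fin.lt_def]
  have := q.isLt
  split_ifs <;> simp

/-- The over-passage of the curl chord. [folklore] -/
theorem overPos_curl_last :
    (G.curl tf ε).overPos (Fin.last G.n) = if tf then G.curlFst else G.curlSnd := by
  rw [← curlPos_eq]
  exact G.insertChord_overPos_last _ _ ε

/-- The under-passage of the curl chord. [folklore] -/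
theorem underPos_curl_last :
    (G.curl tf ε).underPos (Fin.last G.n) = if tf then G.curlSnd else G.curlFst := by
  rw [← succAbove_curlPos]
  exact G.insertChord_underPos_last _ _ ε

/-- Old chords keep their over-passages. [folklore] -/
@[simp]
theorem overPos_curl_castSucc (i : Fin G.n) :
    (G.curl tf ε).overPos i.castSucc = (G.overPos i).castSucc.castSucc := by
  rw [← insEmb_curlPos G tf]
  exact G.insertChord_overPos_castSucc_eq _ _ ε i

/-- Old chords keep their under-passages. [folklore] -/
@[simp]
theorem underPos_curl_castSucc (i : Fin G.n) :
    (G.curl tf ε).underPos i.castSucc = (G.underPos i).castSucc.castSucc := by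
  rw [← insEmb_curlPos G tf]
  exact G.insertChord_underPos_castSucc_eq _ _ ε i

/-- The sign of the curl chord. [folklore] -/
@[simp] theorem sign_curl_last : (G.curl tf ε).sign (Fin.last G.n) = ε :=
  G.insertChord_sign_last _ _ ε

/-- Old chords keep their signs. [folklore] -/
@[simp] theorem sign_curl_castSucc (i : Fin G.n) : (G.curl tf ε).sign i.castSucc = G.sign i :=
  G.insertChord_sign_castSucc _ _ ε i

/-- The chord through an old marked point. [folklore] -/
@[simp]
theorem chordOf_curl_castSucc (q : Fin (2 * G.n)) :
    (G.curl tf ε).chordOf q.castSucc.castSucc = (G.chordOf q).castSucc := by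
  rw [← insEmb_curlPos G tf q]
  exact G.chordOf_insertChord_insEmb _ _ ε q

/-- The chord through `2n` is the curl. [folklore] -/
@[simp]
theorem chordOf_curl_curlFst : (G.curl tf ε).chordOf G.curlFst = Fin.last G.n := by
  rw [chordOf_eq_iff, overPos_curl_last, underPos_curl_last]
  cases tf <;> simp

/-- The chord through `2n + 1` is the curl. [folklore] -/
@[simp]
theorem chordOf_curl_curlSnd : (G.curl tf ε).chordOf G.curlSnd = Fin.last G.n := by
  rw [chordOf_eq_iff, overPos_curl_last, underPos_curl_last]
  cases tf <;> simp

/-- The partner of an old marked point. [folklore] -/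
@[simp]
theorem partner_curl_castSucc (q : Fin (2 * G.n)) :
    (G.curl tf ε).partner q.castSucc.castSucc = (G.partner q).castSucc.castSucc := by
  rw [← insEmb_curlPos G tf q, ← insEmb_curlPos G tf (G.partner q)]
  exact G.partner_insertChord_insEmb _ _ ε q

/-- The partner of `2n` is `2n + 1`. [folklore] -/
@[simp]
theorem partner_curl_curlFst : (G.curl tf ε).partner G.curlFst = G.curlSnd := by
  unfold partner
  rw [chordOf_curl_curlFst, overPos_curl_last, underPos_curl_last]
  have := G.curlFst_ne_curlSnd
  cases tf <;> simp [this.symm]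

/-- The partner of `2n + 1` is `2n`. [folklore] -/
@[simp]
theorem partner_curl_curlSnd : (G.curl tf ε).partner G.curlSnd = G.curlFst := by
  unfold partner
  rw [chordOf_curl_curlSnd, overPos_curl_last, underPos_curl_last]
  have := G.curlFst_ne_curlSnd
  cases tf <;> simp [this]

/-- Every marked point of the curled diagram is an old point, `2n` or `2n + 1`. [folklore] -/
theorem eq_castSucc_or (x : Fin (2 * G.n + 2)) :
    (∃ q : Fin (2 * G.n), x = q.castSucc.castSucc) ∨ x = G.curlFst ∨ x = G.curlSnd := by
  have hx := x.isLt
  by_cases h1 : x.val < 2 * G.n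
  · exact Or.inl ⟨⟨x.val, h1⟩, Fin.ext rfl⟩
  by_cases h2 : x.val = 2 * G.n
  · exact Or.inr (Or.inl (Fin.ext h2))
  · exact Or.inr (Or.inr (Fin.ext (by simp; omega)))

/-! ## States of the curled diagram and the Seifert rule at the curl -/

/-- **The state of the curled diagram** with old smoothings `σ` and smoothing `b` of the curl
chord (`Fin.snoc σ b`). Khovanov (2000), §4.2 (vertices of the cube of `D'` over those of `D`).
[cite: Khovanov2000, §4.2] -/
def curlState (σ : G.State) (b : Bool) : (G.curl tf ε).State := Fin.snoc σ b

/-- The state of the curled diagram at an old chord. [folklore] -/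
@[simp]
theorem curlState_castSucc (σ : G.State) (b : Bool) (j : Fin G.n) :
    G.curlState tf ε σ b j.castSucc = σ j :=
  Fin.snoc_castSucc ..

/-- The state of the curled diagram at the curl chord. [folklore] -/
@[simp]
theorem curlState_last (σ : G.State) (b : Bool) : G.curlState tf ε σ b (Fin.last G.n) = b :=
  Fin.snoc_last ..

/-- Every state of the curled diagram is a `curlState`. [folklore] -/
theorem eq_curlState (σ' : (G.curl tf ε).State) :
    σ' = G.curlState tf ε (fun j ↦ σ' j.castSucc) (σ' (Fin.last G.n)) :=
  (Fin.snoc_init_self σ').symm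

/-- `curlState` is injective in the pair (old smoothings, smoothing of the curl). [folklore] -/
theorem curlState_inj {σ σ' : G.State} {b b' : Bool}
    (h : G.curlState tf ε σ b = G.curlState tf ε σ' b') : σ = σ' ∧ b = b' := by
  constructor
  · funext j
    simpa using congrFun h j.castSucc
  · simpa using congrFun h (Fin.last G.n)

/-- Flipping an old chord of a `curlState`. [folklore] -/
theorem update_curlState_castSucc (σ : G.State) (b : Bool) (j : Fin G.n) (c : Bool) :
    Function.update (G.curlState tf ε σ b) j.castSucc c = G.curlState tf ε (Function.update σ j c) b :=
  (Fin.snoc_update ..).symm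

/-- Flipping the curl chord of a `curlState`. [folklore] -/
theorem update_curlState_last (σ : G.State) (b c : Bool) :
    Function.update (G.curlState tf ε σ b) (Fin.last G.n) c = G.curlState tf ε σ c :=
  Fin.update_snoc_last ..

/-- **Whether the smoothing `b` of the curl chord of sign `ε` is Seifert's**: the `0`-smoothing of
a positive curl and the `1`-smoothing of a negative curl are the orientation-consistent ones (in
which the curl bounds a small separate circle). Bar-Natan (2002), §3.1. [cite: BarNatan2002, §3.1] -/
def curlSeif (b : Bool) (ε : ℤˣ) : Bool := (b == false) == (ε == 1)

/-- The Seifert rule of the curled diagram at the curl chord. [folklore] -/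
@[simp]
theorem isSeifert_curl_last (σ : G.State) (b : Bool) :
    (G.curl tf ε).isSeifert (G.curlState tf ε σ b) (Fin.last G.n) = curlSeif b ε :=
  G.isSeifert_insertChord_last _ _ ε σ b

/-- The Seifert rule of the curled diagram at an old chord. [folklore] -/
@[simp]
theorem isSeifert_curl_castSucc (σ : G.State) (b : Bool) (j : Fin G.n) :
    (G.curl tf ε).isSeifert (G.curlState tf ε σ b) j.castSucc = G.isSeifert σ j :=
  G.isSeifert_insertChord_castSucc _ _ ε σ b j

/-- Flipping the curl flips its Seifert rule. [folklore] -/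
theorem curlSeif_not (b : Bool) (ε : ℤˣ) : curlSeif (!b) ε = !curlSeif b ε := by
  cases b <;> simp [curlSeif]

/-- Seifert's smoothing of the curl is the `0`-smoothing iff the curl is positive. [folklore] -/
theorem curlSeif_false_iff (ε : ℤˣ) : curlSeif false ε = true ↔ ε = 1 := by
  simp [curlSeif]

/-- Seifert's smoothing of the curl is the `1`-smoothing iff the curl is negative. [folklore] -/
theorem curlSeif_true_iff (ε : ℤˣ) : curlSeif true ε = true ↔ ε = -1 := by
  rcases Int.units_eq_one_or ε with rfl | rfl <;> simp [curlSeif]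

/-- The weight of a state of the curled diagram. Bar-Natan (2002), §3.1. [cite: BarNatan2002, §3.1] -/
theorem weight_curlState (σ : G.State) (b : Bool) :
    State.weight (G.curlState tf ε σ b) = σ.weight + if b then 1 else 0 :=
  G.weight_snoc _ _ ε σ b

/-- The number of positive crossings of the curled diagram. [folklore] -/
theorem nPlus_curl : (G.curl tf ε).nPlus = G.nPlus + if ε = 1 then 1 else 0 :=
  G.nPlus_insertChord _ _ ε

/-- The number of negative crossings of the curled diagram. [folklore] -/
theorem nMinus_curl : (G.curl tf ε).nMinus = G.nMinus + if ε = -1 then 1 else 0 :=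
  G.nMinus_insertChord _ _ ε

/-- Old chords keep their Koszul signs in the curled diagram. Khovanov (2000), §3.3. [cite: Khovanov2000, §3.3] -/
theorem edgeSign_curlState_castSucc (σ : G.State) (b : Bool) (j : Fin G.n) :
    edgeSign (G.curlState tf ε σ b) j.castSucc = edgeSign σ j :=
  G.edgeSign_snoc_castSucc _ _ ε σ b j

/-- The Koszul sign of the curl chord is `(-1)^{|σ|}`. Khovanov (2000), §3.3, §4.2. [cite: Khovanov2000, §4.2] -/
theorem edgeSign_curlState_last (σ : G.State) (b : Bool) :
    edgeSign (G.curlState tf ε σ b) (Fin.last G.n) = (-1) ^ σ.weight :=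
  G.edgeSign_snoc_last _ _ ε σ b

/-! ## Arcs of the curled diagram -/

/-- The curled diagram has `2n + 2` arcs. [folklore] -/
theorem arcCount_curl : (G.curl tf ε).arcCount = 2 * G.n + 2 := by
  show max (2 * (G.n + 1)) 1 = 2 * G.n + 2
  omega

/-- **The loop of the curl**: the arc from `2n` to `2n + 1`, which in Seifert's smoothing of the
curl is a state circle by itself. Khovanov (2000), §5.1; Bar-Natan (2002), §4. [cite: Khovanov2000, §5.1] -/
def curlLoop : (G.curl tf ε).Arc := (G.curl tf ε).arcOut G.curlFst

/-- **The outgoing half** of the subdivided old arc: the arc from `2n + 1` to `0`. [folklore] -/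
def curlOut : (G.curl tf ε).Arc := (G.curl tf ε).arcOut G.curlSnd

/-- The old arc subdivided by the curl: arc number `2n - 1`, from the old point `2n - 1` to the
old point `0` (the single arc for the empty diagram). [folklore] -/
def baseArc : G.Arc := ⟨2 * G.n - 1, by unfold arcCount; omega⟩

/-- **The projection of the arcs of the curled diagram to the arcs of `G`**: every arc goes to
the old arc containing it (`arcOut q ↦ arcOut q` for old `q`, the loop and the two halves of the
subdivided arc to `baseArc`). [folklore] -/
def curlProj (x : (G.curl tf ε).Arc) : G.Arc :=
  ⟨min x.val (2 * G.n - 1), by unfold arcCount; omega⟩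

/-- The loop has number `2n`. [folklore] -/
@[simp] theorem val_curlLoop : (G.curlLoop tf ε : ℕ) = 2 * G.n := rfl

/-- The outgoing half has number `2n + 1`. [folklore] -/
@[simp] theorem val_curlOut : (G.curlOut tf ε : ℕ) = 2 * G.n + 1 := rfl

/-- The subdivided arc has number `2n - 1`. [folklore] -/
@[simp] theorem val_baseArc : (G.baseArc : ℕ) = 2 * G.n - 1 := rfl

/-- The value of the projection. [folklore] -/
@[simp] theorem val_curlProj (x : (G.curl tf ε).Arc) :
    (G.curlProj tf ε x : ℕ) = min x.val (2 * G.n - 1) := rfl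

/-- The arc entering `2n + 1` is the loop. [folklore] -/
@[simp]
theorem arcIn_curl_curlSnd : (G.curl tf ε).arcIn G.curlSnd = G.curlLoop tf ε := by
  apply Fin.ext
  rw [arcIn_val]
  simp

/-- The incoming half of the subdivided arc, `arcIn 2n`, has number `2n - 1` (and is the
outgoing half, number `1`, for the empty diagram). [folklore] -/
theorem val_arcIn_curl_curlFst :
    ((G.curl tf ε).arcIn G.curlFst : ℕ) = if G.n = 0 then 1 else 2 * G.n - 1 := by
  rw [arcIn_val]
  simp only [val_curlFst, curl_n]
  split_ifs <;> omega

/-- Old outgoing arcs keep their numbers. [folklore] -/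
@[simp]
theorem val_arcOut_curl_castSucc (q : Fin (2 * G.n)) :
    ((G.curl tf ε).arcOut q.castSucc.castSucc : ℕ) = q := rfl

/-- Old incoming arcs keep their numbers, except that the arc entering `0` is now the outgoing
half, number `2n + 1`. [folklore] -/
theorem val_arcIn_curl_castSucc (q : Fin (2 * G.n)) :
    ((G.curl tf ε).arcIn q.castSucc.castSucc : ℕ) = if q.val = 0 then 2 * G.n + 1 else q.val - 1 := by
  rw [arcIn_val]
  simp only [Fin.val_castSucc, curl_n]
  split_ifs <;> omega

/-- The projection of an old outgoing arc. [folklore] -/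
@[simp]
theorem curlProj_arcOut_castSucc (q : Fin (2 * G.n)) :
    G.curlProj tf ε ((G.curl tf ε).arcOut q.castSucc.castSucc) = G.arcOut q := by
  apply Fin.ext
  have := q.isLt
  rw [val_curlProj, val_arcOut_curl_castSucc, arcOut_val]
  omega

/-- The projection of an old incoming arc. [folklore] -/
@[simp]
theorem curlProj_arcIn_castSucc (q : Fin (2 * G.n)) :
    G.curlProj tf ε ((G.curl tf ε).arcIn q.castSucc.castSucc) = G.arcIn q := by
  apply Fin.ext
  have := q.isLt
  rw [val_curlProj, val_arcIn_curl_castSucc, arcIn_val]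
  split_ifs <;> omega

/-- The loop projects to the subdivided arc. [folklore] -/
@[simp]
theorem curlProj_curlLoop : G.curlProj tf ε (G.curlLoop tf ε) = G.baseArc := by
  apply Fin.ext
  simp only [val_curlProj, val_curlLoop, val_baseArc]
  omega

/-- The outgoing half projects to the subdivided arc. [folklore] -/
@[simp]
theorem curlProj_curlOut : G.curlProj tf ε (G.curlOut tf ε) = G.baseArc := by
  apply Fin.ext
  simp only [val_curlProj, val_curlOut, val_baseArc]
  omega

/-- The incoming half projects to the subdivided arc. [folklore] -/
@[simp]
theorem curlProj_arcIn_curlFst : G.curlProj tf ε ((G.curl tf ε).arcIn G.curlFst) = G.baseArc := by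
  apply Fin.ext
  rw [val_curlProj, val_arcIn_curl_curlFst, val_baseArc]
  split_ifs <;> omega

/-- Every arc of the curled diagram is an old outgoing arc, the loop or the outgoing half.
[folklore] -/
theorem eq_arcOut_castSucc_or (x : (G.curl tf ε).Arc) :
    (∃ q : Fin (2 * G.n), x = (G.curl tf ε).arcOut q.castSucc.castSucc) ∨
      x = G.curlLoop tf ε ∨ x = G.curlOut tf ε := by
  have hx : x.val < 2 * G.n + 2 := lt_of_lt_of_eq x.isLt (G.arcCount_curl tf ε)
  by_cases h1 : x.val < 2 * G.n
  · exact Or.inl ⟨⟨x.val, h1⟩, Fin.ext rfl⟩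
  by_cases h2 : x.val = 2 * G.n
  · exact Or.inr (Or.inl (Fin.ext h2))
  · exact Or.inr (Or.inr (Fin.ext (by simp; omega)))

/-- The loop is not an old outgoing arc. [folklore] -/
theorem arcOut_castSucc_ne_curlLoop (q : Fin (2 * G.n)) :
    (G.curl tf ε).arcOut q.castSucc.castSucc ≠ G.curlLoop tf ε := fun h ↦ by
  have h' := congrArg Fin.val h; have := q.isLt; simp at h'; omega

/-- The outgoing half is not an old outgoing arc. [folklore] -/
theorem arcOut_castSucc_ne_curlOut (q : Fin (2 * G.n)) :
    (G.curl tf ε).arcOut q.castSucc.castSucc ≠ G.curlOut tf ε := fun h ↦ by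
  have h' := congrArg Fin.val h; have := q.isLt; simp at h'; omega

/-- The loop is not an old incoming arc. [folklore] -/
theorem arcIn_castSucc_ne_curlLoop (q : Fin (2 * G.n)) :
    (G.curl tf ε).arcIn q.castSucc.castSucc ≠ G.curlLoop tf ε := fun h ↦ by
  have h' := congrArg Fin.val h
  rw [val_arcIn_curl_castSucc, val_curlLoop] at h'
  have := q.isLt
  split_ifs at h' <;> omega

/-- The loop is not the incoming half. [folklore] -/
theorem arcIn_curlFst_ne_curlLoop : (G.curl tf ε).arcIn G.curlFst ≠ G.curlLoop tf ε := fun h ↦ by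
  have h' := congrArg Fin.val h
  rw [val_arcIn_curl_curlFst, val_curlLoop] at h'
  split_ifs at h' <;> omega

/-- The loop is not the outgoing half. [folklore] -/
theorem curlLoop_ne_curlOut : G.curlLoop tf ε ≠ G.curlOut tf ε := fun h ↦ by
  have h' := congrArg Fin.val h; simp at h'

/-- Two arcs off the loop with the same projection are equal, or are the two halves of the
subdivided arc. [folklore] -/
theorem eq_or_of_curlProj_eq {x y : (G.curl tf ε).Arc} (hx : x ≠ G.curlLoop tf ε)
    (hy : y ≠ G.curlLoop tf ε) (h : G.curlProj tf ε x = G.curlProj tf ε y) :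
    x = y ∨ ({x, y} : Set _) = {(G.curl tf ε).arcIn G.curlFst, G.curlOut tf ε} := by
  have h' := congrArg Fin.val h
  simp only [val_curlProj] at h'
  have hxv : x.val < 2 * G.n + 2 := lt_of_lt_of_eq x.isLt (G.arcCount_curl tf ε)
  have hyv : y.val < 2 * G.n + 2 := lt_of_lt_of_eq y.isLt (G.arcCount_curl tf ε)
  have hxl : x.val ≠ 2 * G.n := fun e ↦ hx (Fin.ext e)
  have hyl : y.val ≠ 2 * G.n := fun e ↦ hy (Fin.ext e)
  by_cases hxy : x.val = y.val
  · exact Or.inl (Fin.ext hxy)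
  · right
    have hin : ((G.curl tf ε).arcIn G.curlFst : ℕ) = if G.n = 0 then 1 else 2 * G.n - 1 :=
      G.val_arcIn_curl_curlFst tf ε
    have key : (x.val = (if G.n = 0 then 1 else 2 * G.n - 1) ∧ y.val = 2 * G.n + 1) ∨
        (y.val = (if G.n = 0 then 1 else 2 * G.n - 1) ∧ x.val = 2 * G.n + 1) := by
      split_ifs with hn <;> omega
    rcases key with ⟨h1, h2⟩ | ⟨h1, h2⟩
    · rw [show x = (G.curl tf ε).arcIn G.curlFst from Fin.ext (by rw [hin, h1]),
        show y = G.curlOut tf ε from Fin.ext h2]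
    · rw [show y = (G.curl tf ε).arcIn G.curlFst from Fin.ext (by rw [hin, h1]),
        show x = G.curlOut tf ε from Fin.ext h2, Set.pair_comm]

/-! ## The gluings of the curled diagram -/

section Glue

variable (σ : G.State) (b : Bool)

/-- The gluing clause of the curled diagram at an old marked point is the old clause, written on
the new arcs entering/leaving the old points. [folklore] -/
theorem glueRel_curl_castSucc (q : Fin (2 * G.n)) (x y : (G.curl tf ε).Arc) :
    (G.curl tf ε).glueRel (G.curlState tf ε σ b) q.castSucc.castSucc x y ↔
      (G.isSeifert σ (G.chordOf q) = true ∧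
          ((x = (G.curl tf ε).arcIn q.castSucc.castSucc ∧
              y = (G.curl tf ε).arcOut (G.partner q).castSucc.castSucc) ∨
            (y = (G.curl tf ε).arcIn q.castSucc.castSucc ∧
              x = (G.curl tf ε).arcOut (G.partner q).castSucc.castSucc))) ∨
        (G.isSeifert σ (G.chordOf q) = false ∧
          ((x = (G.curl tf ε).arcIn q.castSucc.castSucc ∧
              y = (G.curl tf ε).arcIn (G.partner q).castSucc.castSucc) ∨
            (x = (G.curl tf ε).arcOut q.castSucc.castSucc ∧
              y = (G.curl tf ε).arcOut (G.partner q).castSucc.castSucc))) := by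
  simp only [glueRel, chordOf_curl_castSucc, isSeifert_curl_castSucc, partner_curl_castSucc]

/-- The gluing clause of the curled diagram at the point `2n`. [folklore] -/
theorem glueRel_curl_curlFst (x y : (G.curl tf ε).Arc) :
    (G.curl tf ε).glueRel (G.curlState tf ε σ b) G.curlFst x y ↔
      (curlSeif b ε = true ∧
          ((x = (G.curl tf ε).arcIn G.curlFst ∧ y = G.curlOut tf ε) ∨
            (y = (G.curl tf ε).arcIn G.curlFst ∧ x = G.curlOut tf ε))) ∨
        (curlSeif b ε = false ∧
          ((x = (G.curl tf ε).arcIn G.curlFst ∧ y = G.curlLoop tf ε) ∨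
            (x = G.curlLoop tf ε ∧ y = G.curlOut tf ε))) := by
  simp only [glueRel, chordOf_curl_curlFst, isSeifert_curl_last, partner_curl_curlFst,
    arcIn_curl_curlSnd]
  exact Iff.rfl

/-- The gluing clause of the curled diagram at the point `2n + 1`. [folklore] -/
theorem glueRel_curl_curlSnd (x y : (G.curl tf ε).Arc) :
    (G.curl tf ε).glueRel (G.curlState tf ε σ b) G.curlSnd x y ↔
      (curlSeif b ε = true ∧
          ((x = G.curlLoop tf ε ∧ y = G.curlLoop tf ε) ∨
            (y = G.curlLoop tf ε ∧ x = G.curlLoop tf ε))) ∨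
        (curlSeif b ε = false ∧
          ((x = G.curlLoop tf ε ∧ y = (G.curl tf ε).arcIn G.curlFst) ∨
            (x = G.curlOut tf ε ∧ y = G.curlLoop tf ε))) := by
  simp only [glueRel, chordOf_curl_curlSnd, isSeifert_curl_last, partner_curl_curlSnd,
    arcIn_curl_curlSnd]
  exact Iff.rfl

/-- A gluing of the curled diagram at an old point projects to the corresponding gluing of `G`.
[folklore] -/
theorem glueRel_curlProj_of_castSucc {q : Fin (2 * G.n)} {x y : (G.curl tf ε).Arc}
    (h : (G.curl tf ε).glueRel (G.curlState tf ε σ b) q.castSucc.castSucc x y) :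
    G.glueRel σ q (G.curlProj tf ε x) (G.curlProj tf ε y) := by
  rw [glueRel_curl_castSucc] at h
  unfold glueRel
  rcases h with ⟨hs, ⟨rfl, rfl⟩ | ⟨rfl, rfl⟩⟩ | ⟨hs, ⟨rfl, rfl⟩ | ⟨rfl, rfl⟩⟩ <;> simp [hs]

/-- A gluing of the curled diagram at `2n` or `2n + 1` involves only the loop and the two halves
of the subdivided arc, which all project to `baseArc`. [folklore] -/
theorem curlProj_eq_of_glueRel_new {p : Fin (2 * G.n + 2)} (hp : p = G.curlFst ∨ p = G.curlSnd)
    {x y : (G.curl tf ε).Arc} (h : (G.curl tf ε).glueRel (G.curlState tf ε σ b) p x y) :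
    G.curlProj tf ε x = G.baseArc ∧ G.curlProj tf ε y = G.baseArc := by
  rcases hp with rfl | rfl
  · rw [glueRel_curl_curlFst] at h
    rcases h with ⟨-, ⟨rfl, rfl⟩ | ⟨rfl, rfl⟩⟩ | ⟨-, ⟨rfl, rfl⟩ | ⟨rfl, rfl⟩⟩ <;> simp
  · rw [glueRel_curl_curlSnd] at h
    rcases h with ⟨-, ⟨rfl, rfl⟩ | ⟨rfl, rfl⟩⟩ | ⟨-, ⟨rfl, rfl⟩ | ⟨rfl, rfl⟩⟩ <;> simp

/-- **Reachability in the curled diagram projects to reachability in `G`.** [folklore] -/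
theorem reachable_curlProj {x y : (G.curl tf ε).Arc}
    (h : ((G.curl tf ε).stateGraph (G.curlState tf ε σ b)).Reachable x y) :
    (G.stateGraph σ).Reachable (G.curlProj tf ε x) (G.curlProj tf ε y) := by
  obtain ⟨w⟩ := h
  induction w with
  | nil => rfl
  | @cons a c _ hadj _ ih =>
    refine SimpleGraph.Reachable.trans ?_ ih
    rw [stateGraph_adj] at hadj
    obtain ⟨-, p, hp⟩ := hadj
    rcases G.eq_castSucc_or p with ⟨q, rfl⟩ | hnew
    · rcases hp with hp | hp
      · exact G.reachable_of_glueRel σ (G.glueRel_curlProj_of_castSucc tf ε σ b hp)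
      · exact (G.reachable_of_glueRel σ (G.glueRel_curlProj_of_castSucc tf ε σ b hp)).symm
    · rcases hp with hp | hp
      · obtain ⟨h1, h2⟩ := G.curlProj_eq_of_glueRel_new tf ε σ b hnew hp
        rw [h1, h2]
      · obtain ⟨h1, h2⟩ := G.curlProj_eq_of_glueRel_new tf ε σ b hnew hp
        rw [h1, h2]

/-- The two halves of the subdivided arc lie on one state circle of the curled diagram (glued
directly in Seifert's smoothing of the curl, through the loop otherwise). [folklore] -/
theorem reachable_arcIn_curlFst_curlOut :
    ((G.curl tf ε).stateGraph (G.curlState tf ε σ b)).Reachable ((G.curl tf ε).arcIn G.curlFst)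
      (G.curlOut tf ε) := by
  cases hS : curlSeif b ε
  · refine ((G.curl tf ε).reachable_of_glueRel (G.curlState tf ε σ b) (q := G.curlFst)
      (u := (G.curl tf ε).arcIn G.curlFst) (v := G.curlLoop tf ε) ?_).trans
      ((G.curl tf ε).reachable_of_glueRel (G.curlState tf ε σ b) (q := G.curlFst) ?_)
    · rw [glueRel_curl_curlFst]; exact Or.inr ⟨hS, Or.inl ⟨rfl, rfl⟩⟩
    · rw [glueRel_curl_curlFst]; exact Or.inr ⟨hS, Or.inr ⟨rfl, rfl⟩⟩
  · refine (G.curl tf ε).reachable_of_glueRel (G.curlState tf ε σ b) (q := G.curlFst) ?_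
    rw [glueRel_curl_curlFst]; exact Or.inl ⟨hS, Or.inl ⟨rfl, rfl⟩⟩

/-- Outside Seifert's smoothing of the curl, the loop lies on the state circle of the two halves.
[folklore] -/
theorem reachable_curlLoop_curlOut (hS : curlSeif b ε = false) :
    ((G.curl tf ε).stateGraph (G.curlState tf ε σ b)).Reachable (G.curlLoop tf ε)
      (G.curlOut tf ε) := by
  refine (G.curl tf ε).reachable_of_glueRel (G.curlState tf ε σ b) (q := G.curlFst) ?_
  rw [glueRel_curl_curlFst]; exact Or.inr ⟨hS, Or.inr ⟨rfl, rfl⟩⟩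

/-- Arcs off the loop with the same projection lie on one state circle of the curled diagram.
[folklore] -/
theorem reachable_curl_of_curlProj_eq {x y : (G.curl tf ε).Arc} (hx : x ≠ G.curlLoop tf ε)
    (hy : y ≠ G.curlLoop tf ε) (h : G.curlProj tf ε x = G.curlProj tf ε y) :
    ((G.curl tf ε).stateGraph (G.curlState tf ε σ b)).Reachable x y := by
  rcases G.eq_or_of_curlProj_eq tf ε hx hy h with rfl | hset
  · rfl
  · have hx' : x ∈ ({x, y} : Set _) := Set.mem_insert _ _
    have hy' : y ∈ ({x, y} : Set _) := Set.mem_insert_of_mem _ rfl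
    rw [hset] at hx' hy'
    have hr := G.reachable_arcIn_curlFst_curlOut tf ε σ b
    rcases hx' with rfl | rfl <;> rcases hy' with rfl | rfl
    · rfl
    · exact hr
    · exact hr.symm
    · rfl

/-- A gluing of `G` lifts to a gluing of the curled diagram at the corresponding old point,
between arcs off the loop with the given projections. [folklore] -/
theorem exists_glueRel_curl_of_glueRel {q : Fin (2 * G.n)} {x₀ y₀ : G.Arc}
    (h : G.glueRel σ q x₀ y₀) :
    ∃ x y, (G.curl tf ε).glueRel (G.curlState tf ε σ b) q.castSucc.castSucc x y ∧
      G.curlProj tf ε x = x₀ ∧ G.curlProj tf ε y = y₀ ∧ x ≠ G.curlLoop tf ε ∧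
        y ≠ G.curlLoop tf ε := by
  unfold glueRel at h
  rcases h with ⟨hs, ⟨rfl, rfl⟩ | ⟨rfl, rfl⟩⟩ | ⟨hs, ⟨rfl, rfl⟩ | ⟨rfl, rfl⟩⟩
  · exact ⟨_, _, (G.glueRel_curl_castSucc tf ε σ b q _ _).2 (Or.inl ⟨hs, Or.inl ⟨rfl, rfl⟩⟩),
      by simp, by simp, G.arcIn_castSucc_ne_curlLoop tf ε _, G.arcOut_castSucc_ne_curlLoop tf ε _⟩
  · exact ⟨_, _, (G.glueRel_curl_castSucc tf ε σ b q _ _).2 (Or.inl ⟨hs, Or.inr ⟨rfl, rfl⟩⟩),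
      by simp, by simp, G.arcOut_castSucc_ne_curlLoop tf ε _, G.arcIn_castSucc_ne_curlLoop tf ε _⟩
  · exact ⟨_, _, (G.glueRel_curl_castSucc tf ε σ b q _ _).2 (Or.inr ⟨hs, Or.inl ⟨rfl, rfl⟩⟩),
      by simp, by simp, G.arcIn_castSucc_ne_curlLoop tf ε _, G.arcIn_castSucc_ne_curlLoop tf ε _⟩
  · exact ⟨_, _, (G.glueRel_curl_castSucc tf ε σ b q _ _).2 (Or.inr ⟨hs, Or.inr ⟨rfl, rfl⟩⟩),
      by simp, by simp, G.arcOut_castSucc_ne_curlLoop tf ε _, G.arcOut_castSucc_ne_curlLoop tf ε _⟩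

/-- **Reachability in `G` lifts to the curled diagram**, between any arcs off the loop with the
given projections. [folklore] -/
theorem reachable_curl_of_reachable {x₀ y₀ : G.Arc} (h : (G.stateGraph σ).Reachable x₀ y₀)
    {x y : (G.curl tf ε).Arc} (hx : x ≠ G.curlLoop tf ε) (hy : y ≠ G.curlLoop tf ε)
    (hxp : G.curlProj tf ε x = x₀) (hyp : G.curlProj tf ε y = y₀) :
    ((G.curl tf ε).stateGraph (G.curlState tf ε σ b)).Reachable x y := by
  obtain ⟨w⟩ := h
  induction w generalizing x with
  | nil => exact G.reachable_curl_of_curlProj_eq tf ε σ b hx hy (hxp.trans hyp.symm)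
  | @cons a c _ hadj _ ih =>
    rw [stateGraph_adj] at hadj
    obtain ⟨-, q, hq⟩ := hadj
    -- an edge of `G` from `a` to `c` lifts to an edge of the curled diagram between lifts
    have key : ∃ x' c', ((G.curl tf ε).stateGraph (G.curlState tf ε σ b)).Reachable x' c' ∧
        G.curlProj tf ε x' = a ∧ G.curlProj tf ε c' = c ∧ x' ≠ G.curlLoop tf ε ∧
          c' ≠ G.curlLoop tf ε := by
      rcases hq with hq | hq
      · obtain ⟨x', c', hg, h1, h2, h3, h4⟩ := G.exists_glueRel_curl_of_glueRel tf ε σ b hq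
        exact ⟨x', c', (G.curl tf ε).reachable_of_glueRel _ hg, h1, h2, h3, h4⟩
      · obtain ⟨c', x', hg, h1, h2, h3, h4⟩ := G.exists_glueRel_curl_of_glueRel tf ε σ b hq
        exact ⟨x', c', ((G.curl tf ε).reachable_of_glueRel _ hg).symm, h2, h1, h4, h3⟩
    obtain ⟨x', c', hr, h1, h2, h3, h4⟩ := key
    exact ((G.reachable_curl_of_curlProj_eq tf ε σ b hx h3 (hxp.trans h1.symm)).trans hr).trans
      (ih h4 h2 hyp)

/-- **In Seifert's smoothing of the curl the loop is a state circle by itself**: no arc other than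
the loop is reachable from it. Khovanov (2000), §5.1 (`D'(0) = D ⊔ ○`); Bar-Natan (2002), §4.
[cite: Khovanov2000, §5.1] -/
theorem eq_curlLoop_of_reachable (hS : curlSeif b ε = true) {y : (G.curl tf ε).Arc}
    (h : ((G.curl tf ε).stateGraph (G.curlState tf ε σ b)).Reachable (G.curlLoop tf ε) y) :
    y = G.curlLoop tf ε := by
  -- the loop has no neighbour
  have hno : ∀ z, ¬ ((G.curl tf ε).stateGraph (G.curlState tf ε σ b)).Adj (G.curlLoop tf ε) z := by
    intro z hz
    rw [stateGraph_adj] at hz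
    obtain ⟨hne, p, hp⟩ := hz
    rcases G.eq_castSucc_or p with ⟨q, rfl⟩ | rfl | rfl
    · rcases hp with hp | hp <;> rw [glueRel_curl_castSucc] at hp
      · rcases hp with ⟨-, ⟨h1, -⟩ | ⟨-, h1⟩⟩ | ⟨-, ⟨h1, -⟩ | ⟨h1, -⟩⟩
        · exact G.arcIn_castSucc_ne_curlLoop tf ε _ h1.symm
        · exact G.arcOut_castSucc_ne_curlLoop tf ε _ h1.symm
        · exact G.arcIn_castSucc_ne_curlLoop tf ε _ h1.symm
        · exact G.arcOut_castSucc_ne_curlLoop tf ε _ h1.symm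
      · rcases hp with ⟨-, ⟨-, h1⟩ | ⟨h1, -⟩⟩ | ⟨-, ⟨-, h1⟩ | ⟨-, h1⟩⟩
        · exact G.arcOut_castSucc_ne_curlLoop tf ε _ h1.symm
        · exact G.arcIn_castSucc_ne_curlLoop tf ε _ h1.symm
        · exact G.arcIn_castSucc_ne_curlLoop tf ε _ h1.symm
        · exact G.arcOut_castSucc_ne_curlLoop tf ε _ h1.symm
    · rcases hp with hp | hp <;> rw [glueRel_curl_curlFst] at hp
      · rcases hp with ⟨-, ⟨h1, -⟩ | ⟨-, h1⟩⟩ | ⟨h0, -⟩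
        · exact G.arcIn_curlFst_ne_curlLoop tf ε h1.symm
        · exact G.curlLoop_ne_curlOut tf ε h1
        · exact Bool.false_ne_true (h0.symm.trans hS)
      · rcases hp with ⟨-, ⟨-, h1⟩ | ⟨h1, -⟩⟩ | ⟨h0, -⟩
        · exact G.curlLoop_ne_curlOut tf ε h1
        · exact G.arcIn_curlFst_ne_curlLoop tf ε h1.symm
        · exact Bool.false_ne_true (h0.symm.trans hS)
    · rcases hp with hp | hp <;> rw [glueRel_curl_curlSnd] at hp
      · rcases hp with ⟨-, ⟨-, h1⟩ | ⟨h1, -⟩⟩ | ⟨h0, -⟩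
        · exact hne h1.symm
        · exact hne h1.symm
        · exact Bool.false_ne_true (h0.symm.trans hS)
      · rcases hp with ⟨-, ⟨h1, -⟩ | ⟨-, h1⟩⟩ | ⟨h0, -⟩
        · exact hne h1.symm
        · exact hne h1.symm
        · exact Bool.false_ne_true (h0.symm.trans hS)
  obtain ⟨w⟩ := h
  cases w with
  | nil => rfl
  | cons hadj _ => exact (hno _ hadj).elim

end Glue

/-! ## State circles of the curled diagram -/

section Circles

variable (σ : G.State) (b : Bool)

/-- **State circles of the curled diagram outside Seifert's smoothing of the curl**: two arcs lie
on one circle iff their projections do (the loop is inserted in the through strand: resolving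
the curl this way changes nothing). Khovanov (2000), §5.1 (`D'(1) = D`); Bar-Natan (2002), §4.
[cite: Khovanov2000, §5.1] -/
theorem circleOf_curl_eq_iff_of_not_seif (hS : curlSeif b ε = false) (x y : (G.curl tf ε).Arc) :
    (G.curl tf ε).circleOf (G.curlState tf ε σ b) x = (G.curl tf ε).circleOf (G.curlState tf ε σ b) y ↔
      G.circleOf σ (G.curlProj tf ε x) = G.circleOf σ (G.curlProj tf ε y) := by
  simp only [circleOf, SimpleGraph.ConnectedComponent.eq]
  refine ⟨G.reachable_curlProj tf ε σ b, fun h ↦ ?_⟩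
  -- replace the loop by the outgoing half, which has the same projection and circle
  have hL := G.reachable_curlLoop_curlOut tf ε σ b hS
  have key : ∀ z : (G.curl tf ε).Arc, ∃ z', z' ≠ G.curlLoop tf ε ∧
      G.curlProj tf ε z' = G.curlProj tf ε z ∧
        ((G.curl tf ε).stateGraph (G.curlState tf ε σ b)).Reachable z z' := fun z ↦ by
    by_cases hz : z = G.curlLoop tf ε
    · subst hz
      exact ⟨G.curlOut tf ε, (G.curlLoop_ne_curlOut tf ε).symm, by simp, hL⟩
    · exact ⟨z, hz, rfl, SimpleGraph.Reachable.refl _⟩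
  obtain ⟨x', hx', hxp, hxr⟩ := key x
  obtain ⟨y', hy', hyp, hyr⟩ := key y
  exact (hxr.trans (G.reachable_curl_of_reachable tf ε σ b h hx' hy' hxp hyp)).trans hyr.symm

/-- **State circles of the curled diagram in Seifert's smoothing of the curl**: the loop is a
circle by itself, and two other arcs lie on one circle iff their projections do (resolving the
curl à la Seifert splits off one small circle). Khovanov (2000), §5.1 (`D'(0) = D ⊔ ○`);
Bar-Natan (2002), §4. [cite: Khovanov2000, §5.1] -/
theorem circleOf_curl_eq_iff_of_seif (hS : curlSeif b ε = true) (x y : (G.curl tf ε).Arc) :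
    (G.curl tf ε).circleOf (G.curlState tf ε σ b) x = (G.curl tf ε).circleOf (G.curlState tf ε σ b) y ↔
      (x = G.curlLoop tf ε ↔ y = G.curlLoop tf ε) ∧
        (x ≠ G.curlLoop tf ε →
          G.circleOf σ (G.curlProj tf ε x) = G.circleOf σ (G.curlProj tf ε y)) := by
  simp only [circleOf, SimpleGraph.ConnectedComponent.eq]
  constructor
  · intro h
    refine ⟨⟨fun hx ↦ ?_, fun hy ↦ ?_⟩, fun _ ↦ G.reachable_curlProj tf ε σ b h⟩
    · subst hx; exact G.eq_curlLoop_of_reachable tf ε σ b hS h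
    · subst hy; exact G.eq_curlLoop_of_reachable tf ε σ b hS h.symm
  · rintro ⟨h1, h2⟩
    by_cases hx : x = G.curlLoop tf ε
    · rw [hx, h1.1 hx]
    · exact G.reachable_curl_of_reachable tf ε σ b (h2 hx) hx (fun hy ↦ hx (h1.2 hy)) rfl rfl

/-- **Old chords merge in the curled diagram exactly when they merge in `G`** (in either smoothing
of the curl). Khovanov (2000), §5.1; Viro (2004), §5.2. [cite: Khovanov2000, §5.1] -/
theorem isMergeAt_curl_castSucc_iff (i : Fin G.n) :
    (G.curl tf ε).IsMergeAt (G.curlState tf ε σ b) i.castSucc ↔ G.IsMergeAt σ i := by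
  unfold IsMergeAt
  rw [curlState_castSucc, overPos_curl_castSucc]
  refine and_congr Iff.rfl (not_congr ?_)
  cases hS : curlSeif b ε
  · rw [G.circleOf_curl_eq_iff_of_not_seif tf ε σ b hS, curlProj_arcIn_castSucc,
      curlProj_arcOut_castSucc]
  · rw [G.circleOf_curl_eq_iff_of_seif tf ε σ b hS, curlProj_arcIn_castSucc,
      curlProj_arcOut_castSucc]
    have h1 := G.arcIn_castSucc_ne_curlLoop tf ε (G.overPos i)
    have h2 := G.arcOut_castSucc_ne_curlLoop tf ε (G.overPos i)
    simp [h1, h2]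

/-- **Old chords split in the curled diagram exactly when they split in `G`** (in either
smoothing of the curl). Khovanov (2000), §5.1; Viro (2004), §5.2. [cite: Khovanov2000, §5.1] -/
theorem isSplitAt_curl_castSucc_iff (i : Fin G.n) :
    (G.curl tf ε).IsSplitAt (G.curlState tf ε σ b) i.castSucc ↔ G.IsSplitAt σ i := by
  unfold IsSplitAt
  rw [curlState_castSucc, update_curlState_castSucc, overPos_curl_castSucc]
  refine and_congr Iff.rfl (not_congr ?_)
  cases hS : curlSeif b ε
  · rw [G.circleOf_curl_eq_iff_of_not_seif tf ε _ b hS, curlProj_arcIn_castSucc,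
      curlProj_arcOut_castSucc]
  · rw [G.circleOf_curl_eq_iff_of_seif tf ε _ b hS, curlProj_arcIn_castSucc,
      curlProj_arcOut_castSucc]
    have h1 := G.arcIn_castSucc_ne_curlLoop tf ε (G.overPos i)
    have h2 := G.arcOut_castSucc_ne_curlLoop tf ε (G.overPos i)
    simp [h1, h2]

/-- The half of the subdivided arc which is a local strand at the curl chord: the incoming half
for `tf = true` (over-passage at `2n`), the outgoing half for `tf = false` (over-passage at
`2n + 1`); the other local strand is the loop. [folklore] -/
def curlStrand : (G.curl tf ε).Arc := if tf then (G.curl tf ε).arcIn G.curlFst else G.curlOut tf ε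

/-- The local strand half is off the loop. [folklore] -/
theorem curlStrand_ne_curlLoop : G.curlStrand tf ε ≠ G.curlLoop tf ε := by
  unfold curlStrand
  split_ifs
  · exact G.arcIn_curlFst_ne_curlLoop tf ε
  · exact (G.curlLoop_ne_curlOut tf ε).symm

/-- The local strand half projects to the subdivided arc. [folklore] -/
@[simp]
theorem curlProj_curlStrand : G.curlProj tf ε (G.curlStrand tf ε) = G.baseArc := by
  unfold curlStrand
  split_ifs <;> simp

/-- The incoming local strand at the curl chord. [folklore] -/
theorem arcIn_overPos_curl_last :
    (G.curl tf ε).arcIn ((G.curl tf ε).overPos (Fin.last G.n)) =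
      if tf then G.curlStrand tf ε else G.curlLoop tf ε := by
  rw [overPos_curl_last]
  unfold curlStrand
  cases tf <;> simp

/-- The outgoing local strand at the curl chord. [folklore] -/
theorem arcOut_overPos_curl_last :
    (G.curl tf ε).arcOut ((G.curl tf ε).overPos (Fin.last G.n)) =
      if tf then G.curlLoop tf ε else G.curlStrand tf ε := by
  rw [overPos_curl_last]
  unfold curlStrand
  cases tf
  · rfl
  · rfl

/-- In the state `curlState σ b`, the loop and the local strand half lie on different circles iff
`b` is Seifert's smoothing of the curl. [folklore] -/
theorem circleOf_curlLoop_ne_curlStrand_iff :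
    (G.curl tf ε).circleOf (G.curlState tf ε σ b) (G.curlLoop tf ε) ≠
        (G.curl tf ε).circleOf (G.curlState tf ε σ b) (G.curlStrand tf ε) ↔
      curlSeif b ε = true := by
  cases hS : curlSeif b ε
  · rw [Ne, G.circleOf_curl_eq_iff_of_not_seif tf ε σ b hS, curlProj_curlLoop, curlProj_curlStrand]
    simp
  · rw [Ne, G.circleOf_curl_eq_iff_of_seif tf ε σ b hS]
    have := G.curlStrand_ne_curlLoop tf ε
    simp [this]

/-- In the state `curlState σ b`, the two local strands at the curl chord lie on different circles
iff `b` is Seifert's smoothing of the curl. [folklore] -/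
theorem circleOf_strands_curl_last_ne_iff :
    (G.curl tf ε).circleOf (G.curlState tf ε σ b) ((G.curl tf ε).arcIn ((G.curl tf ε).overPos (Fin.last G.n))) ≠
        (G.curl tf ε).circleOf (G.curlState tf ε σ b)
          ((G.curl tf ε).arcOut ((G.curl tf ε).overPos (Fin.last G.n))) ↔
      curlSeif b ε = true := by
  rw [arcIn_overPos_curl_last, arcOut_overPos_curl_last]
  cases tf
  · simp only [Bool.false_eq_true, ↓reduceIte]
    exact G.circleOf_curlLoop_ne_curlStrand_iff false ε σ b
  · simp only [↓reduceIte]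
    rw [ne_comm]
    exact G.circleOf_curlLoop_ne_curlStrand_iff true ε σ b

/-- **The curl chord is a merge exactly for a positive curl** (at its `0`-smoothing): then the
`0`-smoothing is Seifert's, with the loop a separate circle, and the flip joins it to the through
strand. This holds for every Gauss diagram. Khovanov (2000), §5.2; Bar-Natan (2002), §4.
[cite: Khovanov2000, §5.2] -/
theorem isMergeAt_curl_last_iff :
    (G.curl tf ε).IsMergeAt (G.curlState tf ε σ b) (Fin.last G.n) ↔ b = false ∧ ε = 1 := by
  unfold IsMergeAt
  rw [curlState_last, circleOf_strands_curl_last_ne_iff]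
  constructor
  · rintro ⟨rfl, h⟩; exact ⟨rfl, (curlSeif_false_iff ε).1 h⟩
  · rintro ⟨rfl, h⟩; exact ⟨rfl, (curlSeif_false_iff ε).2 h⟩

/-- **The curl chord is a split exactly for a negative curl** (at its `0`-smoothing): then the
`1`-smoothing is Seifert's and the flip splits the loop off the through strand. This holds for
every Gauss diagram. Khovanov (2000), §5.1; Bar-Natan (2002), §4. [cite: Khovanov2000, §5.1] -/
theorem isSplitAt_curl_last_iff :
    (G.curl tf ε).IsSplitAt (G.curlState tf ε σ b) (Fin.last G.n) ↔ b = false ∧ ε = -1 := by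
  unfold IsSplitAt
  rw [curlState_last, update_curlState_last, circleOf_strands_curl_last_ne_iff, curlSeif_true_iff]

end Circles

end GaussDiagram

end Literature.Topology.FourManifolds
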